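import Mathlib.Analysis.SpecialFunctions.Pow.Real
import Mathlib.NumberTheory.NumberField.Completion.InfinitePlace
import Mathlib.FieldTheory.IsAlgClosed.Basic
import Mathlib.Analysis.Complex.Polynomial.Basic
import Literature.NumberTheory.GaloisRepresentations.UnitIdeles
import Literature.NumberTheory.GaloisRepresentations.LocalUnitsPrimeToPProofs
import HarnessLib

/-!
# `ℤ_p`-valued idele class characters are determined at the places above `p` (proofs only)

Topic `NumberTheory/GaloisRepresentations` (ideles; Iwasawa theory); namespace
`Literature.IdelicCharacter`.  No new definitions.

Let `K` be a number field, `p` a prime and `f : 𝕀_K → ℤ_p` a continuous homomorphism trivial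
on `Kˣ` (a `ℤ_p`-valued character of the idele class group `C_K`).  Then `f` is determined by
its restrictions to the local unit groups `𝒪_vˣ`, `v ∣ p`: if `f(𝒪_vˣ) = 0` for all `v ∣ p`
then `f = 0` (`eq_one_of_forall_localUnits`).  Ingredients:

* `f` kills the archimedean ideles (`map_infiniteIdeles_eq_one`): every element of `K_wˣ`
  (`K_w = ℝ` or `ℂ`) has a square which is infinitely divisible, and `ℤ_p` has no infinitely
  divisible elements (`eq_one_of_forall_exists_pow_eq`) — no continuity needed;
* `f` kills `𝒪_vˣ` for `v ∤ p` (`OneUnits.continuousMonoidHom_eq_one_of_not_mem`, via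
  `continuous_localUnits_unitsMap`);
* `f` kills every unit idele (`map_eq_one_of_mem_unitIdeles`): by continuity `f ≡ 0 (mod p^N)`
  on a congruence subgroup (`Literature.NumberTheory.GaloisRepresentations.ideleGroup_exists_congruenceSubgroup_subset`), and a unit idele
  is a finite product of local units times an element of that subgroup;
* class-number step: `x^h ∈ Kˣ · 𝕌_K`
  (`Automorphic.FiniteAdeleRing.exists_unitOrd_pow_card_classGroup_eq_zero`).

This is the injectivity half of Washington's computation of `Gal(K̃/K)` (*Introduction to
Cyclotomic Fields*, §13.1, proof of Thm. 13.4: `Hom(Gal(K̃/K), ℤ_p) ↪ Hom(∏_{𝔭∣p} U_𝔭, ℤ_p)`),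
on the idelic side of the reciprocity law.

## References

* L. C. Washington, *Introduction to Cyclotomic Fields*, 2nd ed., GTM 83, §13.1, Thm. 13.4.
* J. Neukirch, *Algebraic Number Theory*, Springer 1999, Ch. VI §1.
-/

noncomputable section

open NumberField IsDedekindDomain Topology
open scoped RestrictedProduct

namespace Literature.NumberTheory.GaloisRepresentations

namespace IdelicCharacter

universe u

variable {K : Type u} [Field K] [NumberField K] {p : ℕ} [Fact p.Prime]

/-! ### Divisibility kills `ℤ_p`-valued homomorphisms -/

/-- `ℤ_p` has no non-trivial infinitely divisible elements: an element of `Multiplicative ℤ_p`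
with `p^k`-th roots for all `k` is `1`. [folklore] -/
theorem eq_one_of_forall_exists_pow_eq (z : Multiplicative ℤ_[p])
    (hz : ∀ k : ℕ, ∃ b : Multiplicative ℤ_[p], b ^ p ^ k = z) : z = 1 := by
  apply Multiplicative.toAdd.injective
  rw [toAdd_one, ← PadicInt.ext_of_toZModPow]
  intro k
  obtain ⟨b, hb⟩ := hz k
  rw [map_zero, ← hb, toAdd_pow, nsmul_eq_mul, map_mul, map_natCast, ZMod.natCast_self, zero_mul]

/-- A homomorphism into `Multiplicative ℤ_p` kills every element `x` whose square is infinitely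
divisible (`ℤ_p` is torsion-free and reduced). [folklore] -/
theorem map_eq_one_of_sq_divisible {G : Type*} [Group G] (f : G →* Multiplicative ℤ_[p]) (x : G)
    (hx : ∀ n : ℕ, 0 < n → ∃ y : G, y ^ n = x ^ 2) : f x = 1 := by
  have h2 : f x ^ 2 = 1 := by
    rw [← map_pow]
    refine eq_one_of_forall_exists_pow_eq _ fun k => ?_
    obtain ⟨y, hy⟩ := hx (p ^ k) (pow_pos (Fact.out : p.Prime).pos k)
    exact ⟨f y, by rw [← map_pow, hy]⟩
  apply Multiplicative.toAdd.injective
  have h3 : (2 : ℕ) • (f x).toAdd = 0 := by rw [← toAdd_pow, h2, toAdd_one]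
  rw [nsmul_eq_mul, mul_eq_zero] at h3
  rw [toAdd_one]
  exact h3.resolve_left (by norm_num)

/-! ### The archimedean ideles -/

omit [NumberField K] in
/-- In `K_wˣ`, `w` an infinite place (`K_w = ℝ` or `ℂ`), every square has `n`-th roots for all
`n ≥ 1`. [folklore] -/
theorem exists_pow_eq_sq_completion (w : InfinitePlace K) (x : (w.Completion)ˣ) (n : ℕ)
    (hn : 0 < n) : ∃ y : (w.Completion)ˣ, y ^ n = x ^ 2 := by
  rcases w.isReal_or_isComplex with hw | hw
  · -- real place: positive reals have real `n`-th roots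
    let e := InfinitePlace.Completion.ringEquivRealOfIsReal hw
    have hpos : 0 ≤ e ((x : w.Completion) ^ 2) := by rw [map_pow]; exact sq_nonneg _
    set r : ℝ := (e ((x : w.Completion) ^ 2)) ^ ((n : ℝ)⁻¹) with hr
    have hrn : r ^ n = e ((x : w.Completion) ^ 2) := Real.rpow_inv_natCast_pow hpos hn.ne'
    have hr0 : e.symm r ≠ 0 := by
      intro h0
      have : r = 0 := by have h' := congrArg e h0; simp at h'; exact h'
      rw [this, zero_pow hn.ne', map_pow] at hrn
      exact pow_ne_zero 2 (by simp) hrn.symm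
    refine ⟨Units.mk0 (e.symm r) hr0, Units.ext ?_⟩
    rw [Units.val_pow_eq_pow_val, Units.val_mk0, Units.val_pow_eq_pow_val, ← map_pow, hrn,
      RingEquiv.symm_apply_apply]
  · -- complex place: `ℂ` is algebraically closed
    let e := InfinitePlace.Completion.ringEquivComplexOfIsComplex hw
    obtain ⟨z, hz⟩ := IsAlgClosed.exists_pow_nat_eq (e ((x : w.Completion) ^ 2)) hn
    have hz0 : e.symm z ≠ 0 := by
      intro h0
      have : z = 0 := by have h' := congrArg e h0; simp at h'; exact h'
      rw [this, zero_pow hn.ne', map_pow] at hz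
      exact pow_ne_zero 2 (by simp) hz.symm
    refine ⟨Units.mk0 (e.symm z) hz0, Units.ext ?_⟩
    rw [Units.val_pow_eq_pow_val, Units.val_mk0, Units.val_pow_eq_pow_val, ← map_pow, hz,
      RingEquiv.symm_apply_apply]

variable (p) in
/-- **A `ℤ_p`-valued homomorphism of the idele group kills the archimedean ideles**
`(K ⊗ ℝ)ˣ = ∏_{w∣∞} K_wˣ` (each factor has divisible squares).  Ref: Washington, *Introduction
to Cyclotomic Fields*, §13.1 (only the places above `p` contribute). [folklore] -/
theorem map_infiniteIdeles_eq_one (f : ideleGroup K →* Multiplicative ℤ_[p])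
    (z : (InfiniteAdeleRing K)ˣ) : f (infiniteIdeles K z) = 1 := by
  classical
  -- decompose `z` as a product of single-place ideles
  let π : (InfiniteAdeleRing K)ˣ ≃* ∀ w : InfinitePlace K, (w.Completion)ˣ := MulEquiv.piUnits
  have hz : z = ∏ w, π.symm (Pi.mulSingle w (π z w)) := by
    rw [← map_prod, Finset.univ_prod_mulSingle, MulEquiv.symm_apply_apply]
  rw [hz, map_prod, map_prod]
  refine Finset.prod_eq_one fun w _ => ?_
  -- the factor at `w` comes from `K_wˣ`
  let g : (w.Completion)ˣ →* Multiplicative ℤ_[p] :=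
    (f.comp (infiniteIdeles K)).comp (π.symm.toMonoidHom.comp
      (MonoidHom.mulSingle (fun w : InfinitePlace K => (w.Completion)ˣ) w))
  have hg : ∀ y, g y = f (infiniteIdeles K (π.symm (Pi.mulSingle w y))) := fun y => rfl
  rw [← hg]
  exact map_eq_one_of_sq_divisible g _ fun n hn => exists_pow_eq_sq_completion w _ n hn

/-! ### Local units inside the ideles -/

/-- The idele `(…, 1, u, 1, …)` of a local unit `u ∈ 𝒪_vˣ` depends continuously on `u`
(the local integers embed into the finite adeles through the open subring `∏_w 𝒪_w`).
[folklore] -/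
theorem continuous_localUnits_unitsMap (v : HeightOneSpectrum (𝓞 K)) :
    Continuous fun u : (v.adicCompletionIntegers K)ˣ =>
      localUnits v (Units.map ((v.adicCompletionIntegers K).subtype : _ →* _) u) := by
  classical
  -- `z ↦ (…, 1, z, 1, …) : 𝒪_v → 𝔸_K^f` is continuous
  have hsingle : Continuous fun z : v.adicCompletionIntegers K =>
      finiteAdeleSingle v (z : v.adicCompletion K) := by
    have heq : (fun z : v.adicCompletionIntegers K => finiteAdeleSingle v (z : v.adicCompletion K)) =
        (fun g => (RestrictedProduct.structureMap (fun w : HeightOneSpectrum (𝓞 K) => w.adicCompletion K)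
          (fun w => (w.adicCompletionIntegers K : Set (w.adicCompletion K))) Filter.cofinite g :
            FiniteAdeleRing (𝓞 K) K)) ∘ fun z => Pi.mulSingle v z := by
      funext z
      apply RestrictedProduct.ext
      intro w
      change finiteAdeleSingle v (z : v.adicCompletion K) w = ((Pi.mulSingle v z : ∀ w, w.adicCompletionIntegers K) w : w.adicCompletion K)
      by_cases hw : w = v
      · subst hw; rw [finiteAdeleSingle_apply_self, Pi.mulSingle_eq_same]
      · rw [finiteAdeleSingle_apply_of_ne _ hw, Pi.mulSingle_eq_of_ne hw]; rfl
    rw [heq]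
    exact RestrictedProduct.isEmbedding_structureMap.continuous.comp
      (@continuous_mulSingle _ (fun j : HeightOneSpectrum (𝓞 K) => j.adicCompletionIntegers K) _ _ _ v)
  have hA : Continuous fun z : v.adicCompletionIntegers K =>
      ((1 : InfiniteAdeleRing K), finiteAdeleSingle v (z : v.adicCompletion K)) :=
    continuous_const.prodMk hsingle
  refine Units.continuous_iff.2 ⟨?_, ?_⟩
  · exact hA.comp Units.continuous_val
  · have : (fun u : (v.adicCompletionIntegers K)ˣ =>
        (((localUnits v (Units.map ((v.adicCompletionIntegers K).subtype : _ →* _) u))⁻¹ :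
          ideleGroup K) : AdeleRing (𝓞 K) K)) =
        (fun z : v.adicCompletionIntegers K =>
          ((1 : InfiniteAdeleRing K), finiteAdeleSingle v (z : v.adicCompletion K))) ∘
          fun u => ((u⁻¹ : (v.adicCompletionIntegers K)ˣ) : v.adicCompletionIntegers K) := by
      funext u; rw [← map_inv, ← map_inv]; rfl
    rw [this]
    exact hA.comp Units.continuous_coe_inv

/-- The idele of a local unit is a unit idele. [folklore] -/
theorem localUnits_unitsMap_mem_unitIdeles (v : HeightOneSpectrum (𝓞 K))
    (u : (v.adicCompletionIntegers K)ˣ) :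
    localUnits v (Units.map ((v.adicCompletionIntegers K).subtype : _ →* _) u) ∈ unitIdeles K := by
  intro w
  by_cases hw : w = v
  · subst hw
    rw [localUnits_snd_apply_self]
    exact (Valuation.Integers.isUnit_iff_valuation_eq_one
      (Valuation.valuationSubring.integers _)).1 (Units.isUnit u)
  · rw [localUnits_snd_apply_of_ne _ hw, map_one]

/-! ### The main theorem -/

variable (p) in
/-- **A continuous `ℤ_p`-valued homomorphism of `𝕀_K` vanishing on all local unit groups
`𝒪_vˣ`, `v ∣ p`, vanishes on every unit idele.**  It vanishes on `𝒪_vˣ` for `v ∤ p` as well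
(`OneUnits.continuousMonoidHom_eq_one_of_not_mem`) and on the archimedean part
(`map_infiniteIdeles_eq_one`); by continuity it is `≡ 0 (mod p^N)` on a congruence subgroup, and
a unit idele is a finite product of local units times an element of that subgroup.
Ref: Washington, *Introduction to Cyclotomic Fields*, §13.1, proof of Thm. 13.4. [folklore] -/
theorem map_eq_one_of_mem_unitIdeles (f : ideleGroup K →ₜ* Multiplicative ℤ_[p])
    (hloc : ∀ v : HeightOneSpectrum (𝓞 K), (p : 𝓞 K) ∈ v.asIdeal →
      ∀ u : (v.adicCompletionIntegers K)ˣ,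
        f (localUnits v (Units.map ((v.adicCompletionIntegers K).subtype : _ →* _) u)) = 1)
    {x : ideleGroup K} (hx : x ∈ unitIdeles K) : f x = 1 := by
  classical
  -- all local unit groups are killed
  have hall : ∀ (v : HeightOneSpectrum (𝓞 K)) (u : (v.adicCompletionIntegers K)ˣ),
      f (localUnits v (Units.map ((v.adicCompletionIntegers K).subtype : _ →* _) u)) = 1 := by
    intro v u
    by_cases hv : (p : 𝓞 K) ∈ v.asIdeal
    · exact hloc v hv u
    · let ψ : (v.adicCompletionIntegers K)ˣ →ₜ* Multiplicative ℤ_[p] :=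
        { toFun := fun u => f (localUnits v (Units.map ((v.adicCompletionIntegers K).subtype : _ →* _) u))
          map_one' := by rw [map_one, map_one, map_one]
          map_mul' := fun a b => by rw [map_mul, map_mul, map_mul]
          continuous_toFun := f.continuous.comp (continuous_localUnits_unitsMap v) }
      have hψ := OneUnits.continuousMonoidHom_eq_one_of_not_mem K v p hv ψ
      exact DFunLike.congr_fun hψ u
  -- split off the archimedean part
  let xinf : (InfiniteAdeleRing K)ˣ :=
    Units.map (RingHom.fst (InfiniteAdeleRing K) (FiniteAdeleRing (𝓞 K) K)).toMonoidHom x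
  set y : ideleGroup K := x * (infiniteIdeles K xinf)⁻¹ with hy_def
  have hy1 : (y : AdeleRing (𝓞 K) K).1 = 1 := by
    rw [hy_def, ideleGroup_val_fst_mul]
    have h1 : (((infiniteIdeles K xinf)⁻¹ : ideleGroup K) : AdeleRing (𝓞 K) K).1 *
        ((infiniteIdeles K xinf : ideleGroup K) : AdeleRing (𝓞 K) K).1 = 1 :=
      ideleGroup_val_inv_fst_mul _
    have h2 : ((infiniteIdeles K xinf : ideleGroup K) : AdeleRing (𝓞 K) K).1 =
        (x : AdeleRing (𝓞 K) K).1 := rfl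
    rw [h2] at h1
    rw [mul_comm]; exact h1
  have hy2 : ∀ v, (y : AdeleRing (𝓞 K) K).2 v = (x : AdeleRing (𝓞 K) K).2 v := fun v => by
    rw [hy_def, ideleGroup_val_snd_mul, ideleGroup_val_inv_snd]
    have : ((infiniteIdeles K xinf : ideleGroup K) : AdeleRing (𝓞 K) K).2 v = 1 := rfl
    rw [this, inv_one, mul_one]
  have hy : y ∈ unitIdeles K := fun v => by rw [hy2]; exact hx v
  have hxy : x = y * infiniteIdeles K xinf := by rw [hy_def, inv_mul_cancel_right]
  have h3 : f (infiniteIdeles K xinf) = 1 := map_infiniteIdeles_eq_one p f.toMonoidHom xinf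
  rw [hxy, map_mul, h3, mul_one]
  -- `f y ≡ 0 (mod p^N)` for every `N`
  apply Multiplicative.toAdd.injective
  rw [toAdd_one, ← PadicInt.ext_of_toZModPow]
  intro N
  rw [map_zero]
  have hV : IsOpen {z : Multiplicative ℤ_[p] | PadicInt.toZModPow N z.toAdd = 0} :=
    (OneUnits.isOpen_setOf_toZModPow_eq p N 0).preimage continuous_toAdd
  obtain ⟨T, hT, e, hTe⟩ := ideleGroup_exists_congruenceSubgroup_subset
    (f.continuous.continuousAt.preimage_mem_nhds (hV.mem_nhds (by simp)))
  -- the local units of `y` at the places of `T`, as an idele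
  let uy : ∀ v : HeightOneSpectrum (𝓞 K), (v.adicCompletion K)ˣ := fun v =>
    Units.map ((v.adicCompletionIntegers K).subtype : _ →* _) (unitIdeles.localUnit v ⟨y, hy⟩)
  have huy : ∀ v, ((uy v : (v.adicCompletion K)ˣ) : v.adicCompletion K) = (y : AdeleRing (𝓞 K) K).2 v :=
    fun v => rfl
  set L : ideleGroup K := ∏ v ∈ hT.toFinset, localUnits v (uy v) with hL_def
  have hfL : f L = 1 := by
    rw [hL_def, map_prod]
    exact Finset.prod_eq_one fun v _ => hall v _
  -- `y = L · y'` with `y'` in the congruence subgroup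
  have hy' : y * L⁻¹ ∈ f ⁻¹' {z : Multiplicative ℤ_[p] | PadicInt.toZModPow N z.toAdd = 0} := by
    refine hTe _ ?_ (fun v => ?_) (fun v hv => ?_)
    · rw [ideleGroup_val_fst_mul, hy1, one_mul]
      have h1 := ideleGroup_val_inv_fst_mul L
      have h2 : (L : AdeleRing (𝓞 K) K).1 = 1 := by rw [hL_def]; exact fst_prod_localUnits _ _
      rw [h2, mul_one] at h1
      exact h1
    · have := (mul_mem (hy) (inv_mem (Subgroup.prod_mem _ fun w _ =>
        localUnits_unitsMap_mem_unitIdeles w (unitIdeles.localUnit w ⟨y, hy⟩))) :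
          y * L⁻¹ ∈ unitIdeles K)
      exact this v
    · rw [ideleGroup_val_snd_mul, ideleGroup_val_inv_snd, hL_def, snd_prod_localUnits,
        if_pos (hT.mem_toFinset.2 hv), huy, mul_inv_cancel₀, sub_self, map_zero]
      · exact zero_le
      · intro h0
        have := hy v
        rw [h0, map_zero] at this
        exact zero_ne_one this
  rw [Set.mem_preimage, Set.mem_setOf_eq, map_mul, map_inv, hfL, inv_one, mul_one] at hy'
  exact hy'

variable (p) in
/-- **`ℤ_p`-valued characters of the idele class group are determined on `∏_{v∣p} 𝒪_vˣ`.**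
Let `f : 𝕀_K → ℤ_p` be a continuous homomorphism trivial on `Kˣ` and on the local units
`𝒪_vˣ` for all `v ∣ p`.  Then `f = 0`: `f` kills all unit ideles
(`map_eq_one_of_mem_unitIdeles`) and `x^h ∈ Kˣ · 𝕌_K` with `h` the class number
(`Automorphic.FiniteAdeleRing.exists_unitOrd_pow_card_classGroup_eq_zero`), so `h f(x) = 0`.
This is the injectivity `Hom_cont(C_K, ℤ_p) ↪ Hom_cont(∏_{𝔭∣p} U_𝔭, ℤ_p)` behind
`rank_{ℤ_p} Gal(K̃/K) ≤ ∑_{𝔭∣p} [K_𝔭:ℚ_p] - rank Ē`.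
Ref: Washington, *Introduction to Cyclotomic Fields*, §13.1, proof of Thm. 13.4; Lang,
*Cyclotomic Fields I and II*, Ch. 5 §5, Thm. 5.1. [folklore] -/
theorem eq_one_of_forall_localUnits (f : ideleGroup K →ₜ* Multiplicative ℤ_[p])
    (hprinc : ∀ x ∈ principalIdeles K, f x = 1)
    (hloc : ∀ v : HeightOneSpectrum (𝓞 K), (p : 𝓞 K) ∈ v.asIdeal →
      ∀ u : (v.adicCompletionIntegers K)ˣ,
        f (localUnits v (Units.map ((v.adicCompletionIntegers K).subtype : _ →* _) u)) = 1) :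
    f = 1 := by
  classical
  -- class-number step
  set h : ℕ := Fintype.card (ClassGroup (𝓞 K)) with hh_def
  have hh0 : h ≠ 0 := Fintype.card_ne_zero
  let sndU : ideleGroup K →* (FiniteAdeleRing (𝓞 K) K)ˣ :=
    Units.map (RingHom.snd (InfiniteAdeleRing K) (FiniteAdeleRing (𝓞 K) K)).toMonoidHom
  have hdec : ∀ x : ideleGroup K, ∃ k : Kˣ, x ^ h * (principalIdele K k)⁻¹ ∈ unitIdeles K := by
    intro x
    obtain ⟨k, hk⟩ :=
      FiniteAdeleRing.exists_unitOrd_pow_card_classGroup_eq_zero (F := K) (sndU x)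
    refine ⟨k, fun v => ?_⟩
    have h1 := (Automorphic.FiniteAdeleRing.unitOrd_eq_zero_iff _ v).1 (hk v)
    have h2 : sndU (x ^ h * (principalIdele K k)⁻¹) =
        sndU x ^ h * (FiniteAdeleRing.unitEmbedding (𝓞 K) K k)⁻¹ := by
      rw [map_mul, map_pow, map_inv, ← unitsMap_snd_principalIdele]
      rfl
    rw [← hh_def, ← h2] at h1
    exact h1
  ext x
  obtain ⟨k, hk⟩ := hdec x
  have h1 := map_eq_one_of_mem_unitIdeles p f hloc hk
  rw [map_mul, map_inv, hprinc _ (principalIdele_mem k), inv_one, mul_one, map_pow] at h1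
  apply Multiplicative.toAdd.injective
  have h2 : h • (f x).toAdd = 0 := by rw [← toAdd_pow, h1, toAdd_one]
  rw [nsmul_eq_mul, mul_eq_zero] at h2
  exact h2.resolve_left (by exact_mod_cast hh0)

end IdelicCharacter

end Literature.NumberTheory.GaloisRepresentations
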